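import Mathlib
import Literature.Analysis.FluidPDE.KNSSLiouvillePlanarHolds
import Literature.Analysis.FluidPDE.KNSSProp41MildHolds
import Literature.Analysis.FluidPDE.OseenHeatKernelBridge
import Literature.Analysis.FluidPDE.TaoQuantitativeTotalSpeed
import Summits.NavierStokesRegularity.NavierStokesRegularity.Theses.SlicedKelvin

/-!
# Crux `SlicedKelvin.FluxZoom` (stmt-NavierStokesRegularity-15603), line `registered`,
# stub `stub_oseenBoxRegularity`: KNSS §4 regularity of bounded Oseen-mild fields on a window

Support file (theorems only, `--supports stmt-NavierStokesRegularity-15603`) for the lead's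
skeleton of the crux `FluxZoom` of route `SlicedKelvin`. For every bound `N` and every window
length `T > 0` there are constants `C L : ℕ → ℝ → ℝ` such that every field
`V : ℝ → ℝ³ → ℝ³` which is continuous on `(0, T) × ℝ³`, has weakly divergence-free slices, is
bounded by `N` on the window and satisfies the Oseen integral identity
`V(t) = e^{(t−s)Δ}V(s) − B¹ₛ(V, V)(t)` pointwise for all `0 < s < t < T`, is jointly `C^∞` on
`(0, T) × ℝ³`, has divergence-free slices, and obeys the uniform bounds
`‖∇ᵏV(t, x)‖ ≤ C k δ` for `t ∈ (δ, T)` and `‖∇ᵏV(t, x) − ∇ᵏV(s, x)‖ ≤ L k δ · |t − s|` for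
`s, t ∈ (δ, T)`.

## Proof

The constants are those of the discharged named fact `KNSS2009_mild_regularity_holds N T hT`
(KNSS 2009, §4, Prop. 4.1 with (4.6) and (4.8)–(4.11) for bounded mild solutions restarted at
every time, `IsKNSSDriftMild T N · 0`). Given `V`, the measurable modification
`V' = 1_{(0,T)} V` (equal to `V` at every time of the window, `0` outside; jointly measurable by
Mathlib's `ContinuousOn.measurable_piecewise`) is a zero-drift drift-mild field
`IsKNSSDriftMild T N V' 0`: the drift-mild identity of the structure is the Oseen identity of the
hypothesis through the bridge `driftDuhamel_zero_eq_oseenDuhamel` (the `oseenHeat` realisation of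
the Duhamel term equals the kernel realisation `oseenDuhamel`) and the locality of `B¹ₛ(·,·)(t)`
in the time window `(s, t)` (`oseenDuhamel_congr_Ioo`). The derivative and Lipschitz bounds and
the divergence-freeness of the slices of `V'` are the conclusions of
`KNSS2009_mild_regularity_holds`; the joint smoothness is the first conclusion of
`KNSS2009_prop41_mild_holds` (Prop. 4.1: bounded mild solutions are jointly smooth). Everything
transfers back to `V` because `V' = V` on `(0, T)`.

No named fact is assumed: every ingredient is a theorem of the tree.

## References

* G. Koch, N. Nadirashvili, G. Seregin, V. Šverák, *Liouville theorems for the Navier–Stokes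
  equations and applications*, Acta Math. 203 (2009) 83–105 = arXiv:0709.3599v1, §4 p. 8:
  Proposition 4.1 with (4.6), and (4.8)–(4.11). [KochNadirashviliSereginSverak2009]
-/

noncomputable section

-- the summit and its single sub-problem share the name (CONVENTIONS §1), as in every Theorems file
set_option linter.dupNamespace false

open MeasureTheory Set Function Filter Topology
open scoped ENNReal NNReal ContDiff

namespace Summit.NavierStokesRegularity.NavierStokesRegularity.Theorems.FluxZoom.Registered

open Literature.Analysis.FluidPDE Literature.Analysis

/-- **The measurable modification of a bounded continuous Oseen-mild field is drift-mild with
zero drift.** If `V` is continuous on `(0, T) × ℝ³`, has weakly divergence-free slices, is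
bounded by `N` there and satisfies `V(t) = e^{(t−s)Δ}V(s) − B¹ₛ(V, V)(t)` pointwise for all
`0 < s < t < T`, then `V' = 1_{(0,T)} V` satisfies `IsKNSSDriftMild T N V' 0` (KNSS 2009, §4 (i):
a bounded mild solution restarted at every time, in the heat-flow realisation of the tree; the
two realisations of the Duhamel term agree by `driftDuhamel_zero_eq_oseenDuhamel`). -/
theorem oseenBox_isKNSSDriftMild_indicator {N T : ℝ} (hT : 0 < T)
    {V : ℝ → EuclideanSpace ℝ (Fin 3) → EuclideanSpace ℝ (Fin 3)}
    (hVc : ContinuousOn (Function.uncurry V) (Set.Ioo 0 T ×ˢ Set.univ))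
    (hVdiv : ∀ t ∈ Set.Ioo 0 T, IsWeaklyDivFree (V t))
    (hVN : ∀ t ∈ Set.Ioo 0 T, ∀ x, ‖V t x‖ ≤ N)
    (hVmild : ∀ s t : ℝ, 0 < s → s < t → t < T → ∀ x,
      V t x = UnboundedOperators.heatExtension (V s) (t - s) x - oseenDuhamel 1 s V V t x) :
    IsKNSSDriftMild T N ((Set.Ioo 0 T).indicator V) 0 := by
  set V' : ℝ → EuclideanSpace ℝ (Fin 3) → EuclideanSpace ℝ (Fin 3) := (Ioo 0 T).indicator V
  have hV'eq : ∀ t ∈ Ioo 0 T, V' t = V t := fun t ht => Set.indicator_of_mem ht V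
  have hV'out : ∀ t ∉ Ioo 0 T, V' t = 0 := fun t ht => Set.indicator_of_notMem ht V
  -- `0 ≤ N`, from the bound at one point of the nonempty window
  have hN0 : 0 ≤ N := (norm_nonneg _).trans (hVN (T / 2) ⟨half_pos hT, half_lt_self hT⟩ 0)
  -- joint measurability of the modification
  have hmeas : Measurable (uncurry V') := by
    classical
    have hpw : uncurry V' =
        (Ioo 0 T ×ˢ (univ : Set (EuclideanSpace ℝ (Fin 3)))).piecewise (uncurry V)
          fun _ => 0 := by
      funext p
      rcases p with ⟨t, x⟩
      by_cases ht : t ∈ Ioo 0 T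
      · rw [piecewise_eq_of_mem _ _ _ (mk_mem_prod ht (mem_univ x)), uncurry_apply_pair,
          uncurry_apply_pair, hV'eq t ht]
      · have hnot : (t, x) ∉ Ioo 0 T ×ˢ (univ : Set (EuclideanSpace ℝ (Fin 3))) :=
          fun h => ht h.1
        simp only [piecewise_eq_of_notMem _ _ _ hnot, uncurry_apply_pair, hV'out t ht,
          Pi.zero_apply]
    rw [hpw]
    exact hVc.measurable_piecewise continuousOn_const (measurableSet_Ioo.prod MeasurableSet.univ)
  refine IsKNSSDriftMild.mk measurable_const (fun _ => by simpa using hN0) hmeas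
    (fun t ht x => ?_) ?_ ?_
  · -- the bound on the window
    rw [hV'eq t ht]
    exact hVN t ht x
  · -- weak divergence-freeness at every (hence a.e.) time of the window
    refine (ae_restrict_mem measurableSet_Ioo).mono fun t ht => ?_
    rw [hV'eq t ht]
    exact hVdiv t ht
  · -- the drift-mild identity = the Oseen identity, through the bridge
    intro s t hs hst htT x
    have hsub : Ioo s t ⊆ Ioo 0 T := fun σ hσ => ⟨hs.trans hσ.1, hσ.2.trans htT⟩
    have hVm : ∀ σ ∈ Ioo s t, Measurable (V' σ) := fun σ _ =>
      hmeas.comp (measurable_const.prodMk measurable_id)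
    have hVN' : ∀ σ ∈ Ioo s t, ∀ y, ‖V' σ y‖ ≤ N := fun σ hσ y => by
      rw [hV'eq σ (hsub hσ)]
      exact hVN σ (hsub hσ) y
    have hcongr : ∀ τ ∈ Ioo s t, V' τ = V τ := fun τ hτ => hV'eq τ (hsub hτ)
    rw [driftDuhamel_zero_eq_oseenDuhamel finrank_euclideanSpace_fin hVm hVN' hst.le x,
      oseenDuhamel_congr_Ioo hcongr hcongr x, hV'eq t ⟨hs.trans hst, htT⟩,
      hV'eq s ⟨hs, hst.trans htT⟩]
    exact hVmild s t hs hst htT x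

/-- **Stub `stub_oseenBoxRegularity` of the crux `SlicedKelvin.FluxZoom`, line `registered`
(KNSS 2009, §4 for bounded Oseen-mild fields on a window, constants uniform in the field).**
For every `N` and `T > 0` there are `C L : ℕ → ℝ → ℝ` such that every field `V`, continuous on
`(0, T) × ℝ³`, with weakly divergence-free slices, bounded by `N`, and satisfying the Oseen
identity `V(t) = e^{(t−s)Δ}V(s) − B¹ₛ(V, V)(t)` for all `0 < s < t < T`, is jointly `C^∞` on
`(0, T) × ℝ³`, has divergence-free slices, `‖∇ᵏV(t, x)‖ ≤ C k δ` on `(δ, T)` and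
`‖∇ᵏV(t, x) − ∇ᵏV(s, x)‖ ≤ L k δ · |t − s|` for `s, t ∈ (δ, T)` (`KNSS2009_mild_regularity_holds`
and the joint smoothness of `KNSS2009_prop41_mild_holds`, applied to the drift-mild structure
`IsKNSSDriftMild T N V' 0` of the measurable modification `V' = 1_{(0,T)} V`,
`oseenBox_isKNSSDriftMild_indicator`). -/
theorem stub_oseenBoxRegularity :
    ∀ (N T : ℝ), 0 < T → ∃ (C L : ℕ → ℝ → ℝ),
      ∀ (V : ℝ → EuclideanSpace ℝ (Fin 3) → EuclideanSpace ℝ (Fin 3)),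
        ContinuousOn (Function.uncurry V) (Set.Ioo 0 T ×ˢ Set.univ) →
        (∀ t ∈ Set.Ioo 0 T, Literature.Analysis.FluidPDE.IsWeaklyDivFree (V t)) →
        (∀ t ∈ Set.Ioo 0 T, ∀ x, ‖V t x‖ ≤ N) →
        (∀ s t : ℝ, 0 < s → s < t → t < T → ∀ x,
          V t x = Literature.Analysis.UnboundedOperators.heatExtension (V s) (t - s) x -
            Literature.Analysis.FluidPDE.oseenDuhamel 1 s V V t x) →
        ContDiffOn ℝ (⊤ : ℕ∞) (Function.uncurry V) (Set.Ioo 0 T ×ˢ Set.univ) ∧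
        (∀ t ∈ Set.Ioo 0 T, Literature.Analysis.FluidPDE.VectorCalculus.IsDivFree (V t)) ∧
        (∀ δ : ℝ, 0 < δ → ∀ k : ℕ, ∀ t ∈ Set.Ioo δ T, ∀ x,
          ‖iteratedFDeriv ℝ k (V t) x‖ ≤ C k δ) ∧
        (∀ δ : ℝ, 0 < δ → ∀ k : ℕ, ∀ s ∈ Set.Ioo δ T, ∀ t ∈ Set.Ioo δ T, ∀ x,
          ‖iteratedFDeriv ℝ k (V t) x - iteratedFDeriv ℝ k (V s) x‖ ≤ L k δ * |t - s|) := by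
  intro N T hT
  obtain ⟨C, L, hCL⟩ := KNSS2009_mild_regularity_holds N T hT
  obtain ⟨_, -, _, -, h41⟩ := KNSS2009_prop41_mild_holds 0
  refine ⟨C, L, fun V hVc hVdiv hVN hVmild => ?_⟩
  -- the drift-mild structure of the measurable modification `V' = 1_{(0,T)} V`
  have hD : IsKNSSDriftMild T N ((Ioo 0 T).indicator V) 0 :=
    oseenBox_isKNSSDriftMild_indicator hT hVc hVdiv hVN hVmild
  have hV'eq : ∀ t ∈ Ioo 0 T, (Ioo 0 T).indicator V t = V t := fun t ht =>
    Set.indicator_of_mem ht V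
  obtain ⟨-, h2, h3, h4, -⟩ := hCL hD
  have hsm : ContDiffOn ℝ ∞ (uncurry ((Ioo 0 T).indicator V)) (Ioo 0 T ×ˢ univ) := (h41 hD).1
  refine ⟨?_, fun t ht => ?_, fun δ hδ k t ht x => ?_, fun δ hδ k s hs t ht x => ?_⟩
  · -- joint smoothness transfers: `uncurry V = uncurry V'` on the window
    refine hsm.congr ?_
    rintro ⟨t, x⟩ ⟨ht, -⟩
    rw [uncurry_apply_pair, uncurry_apply_pair, hV'eq t ht]
  · rw [← hV'eq t ht]
    exact h2 t ht
  · rw [← hV'eq t ⟨hδ.trans ht.1, ht.2⟩]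
    exact h3 δ hδ k t ht x
  · rw [← hV'eq t ⟨hδ.trans ht.1, ht.2⟩, ← hV'eq s ⟨hδ.trans hs.1, hs.2⟩]
    exact h4 δ hδ k s hs t ht x

end Summit.NavierStokesRegularity.NavierStokesRegularity.Theorems.FluxZoom.Registered

end
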